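import Summits.Ventures.Crystal3D.TopCut.X2D8u060Agg1

/-!
# X2 cap cut `X2D8u060` (u₀ = -3/5, degrees (d, d_X) = (8, 8)): kernel validation of Gram blocks E0, E1, E2 (chunk theorems okE0_1, okE0_2, okE1_1, okE2_1; cost proxy 0.38 Gbit)

HONEST FRAMING: generated data / kernel-validation file of the venture `Crystal3D` (cell `pub-crystal3d`, phase 2,
seat p2): one piece of the kernel replay of an EXACT pole-augmented («X2») Bachoc–Vallentin cap certificate on `S²`
(format `Bulk/CapX2Cert.X2Cert` of seat p1; cap level u₀ = -3/5, inner products ≤ 1/2) solved directly in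
sum-of-squares form (`capx2sos.py` + `exactx2.py`: CLARABEL float solve → exact rounding → integer identities; certificate
`x2sos_d8_dX8_u3over5`, bound value 11.998839 < 12) and checked through `TopCut/X2SOSExpand.lean` + `X2SOSCheck.lean` +
`X2SOSSound.lean` (generic checker + soundness), `TopCut/CapSOSCheck.lean` and the tree's `ThreePointCert.CheckKron`.
Nothing geometric is proved in this file; plain lists of integers / rationals / monomials and `decide +kernel` facts about
them (standard axioms only, no `native_decide`).
-/

namespace Summit.Ventures.Crystal3D.TopCut.X2D8u060

open Literature.Geometry.DiscreteGeometry Literature.Geometry.DiscreteGeometry.PolyCert PolyCert.SPoly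
open Literature.Geometry.DiscreteGeometry.BachocVallentin
open Summit.Ventures.PackingBounds.ThreePointCert Summit.Ventures.Crystal3D.CapSOS Summit.Ventures.Crystal3D.CapX2 Summit.Ventures.Crystal3D.X2SOS

set_option maxRecDepth 100000 in
set_option maxHeartbeats 0 in
/-- Block `E0`: rows from 0 (82 rows) of `zᵀ(LLᵀ)z` added to `[]` give `dE0c1` (kernel, Kronecker-packed chunk check). [folklore] -/
theorem okE0_1 : chunkOKK X2D8u060.gE0K 0 82 [] X2D8u060.dE0c1 = true := by
  decide +kernel

set_option maxRecDepth 100000 in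
set_option maxHeartbeats 0 in
/-- Block `E0`: rows from 82 ((X2D8u060.gE0K.z.length - 82) rows) of `zᵀ(LLᵀ)z` added to `dE0c1` give `eE0` (kernel, Kronecker-packed chunk check). [folklore] -/
theorem okE0_2 : chunkOKK X2D8u060.gE0K 82 (X2D8u060.gE0K.z.length - 82) X2D8u060.dE0c1 X2D8u060.eE0 = true := by
  decide +kernel

set_option maxRecDepth 100000 in
set_option maxHeartbeats 0 in
/-- Block `E1`: rows from 0 (X2D8u060.gE1K.z.length rows) of `zᵀ(LLᵀ)z` added to `[]` give `eE1` (kernel, Kronecker-packed chunk check). [folklore] -/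
theorem okE1_1 : chunkOKK X2D8u060.gE1K 0 X2D8u060.gE1K.z.length [] X2D8u060.eE1 = true := by
  decide +kernel

set_option maxRecDepth 100000 in
set_option maxHeartbeats 0 in
/-- Block `E2`: rows from 0 (X2D8u060.gE2K.z.length rows) of `zᵀ(LLᵀ)z` added to `[]` give `eE2` (kernel, Kronecker-packed chunk check). [folklore] -/
theorem okE2_1 : chunkOKK X2D8u060.gE2K 0 X2D8u060.gE2K.z.length [] X2D8u060.eE2 = true := by
  decide +kernel

end Summit.Ventures.Crystal3D.TopCut.X2D8u060
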